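import Summits.AtomisticToContinuum.HydrodynamicLimit.Theses.JParityClosure
import Summits.AtomisticToContinuum.HydrodynamicLimit.Theorems.JParityClosureRateFloorPairFunctionalRung0Integrability
import Summits.AtomisticToContinuum.HydrodynamicLimit.Theorems.LambertianContactSwapSwapGapGibbsDomination
import Summits.AtomisticToContinuum.HydrodynamicLimit.Theorems.JParityClosureRateFloorGAfterR
import Literature.MathematicalPhysics.KineticTheory.CollisionTubePullbackPacking
import HarnessLib

/-!
# Crux `JParityClosure.RateFloor` (stmt-AtomisticToContinuum-13080), line `Sketch`: with the floor constant AFTER the slack `η` the crux is junk-true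

Support file (`--supports stmt-AtomisticToContinuum-13080`; registered stub `stub_rateFloorGAfterEta`, continuation lead c4) — a
QUANTIFIER-ORDER RECORD (not a step of the crux proof; companion of `JParityClosureRateFloorGAfterR`, where `g₀` comes after `r`).
Here `g₀` is chosen after `η, δ` but BEFORE the mollification scale `r` and `N`, and the statement is still content-free: for every
continuous positive local Gibbs datum, `σ ≤ 1/2`, flow family, `τ`, continuous `χ ≥ 0`, bounded continuous `Ξ ≥ 0`, `η, δ > 0`
there is `g₀ = g₀(η, δ, τ, ‖χ‖_∞, ‖Ξ‖_∞, A) > 0` with `LG_N(K_N[χΞ] < g₀σ³∫₀^τ∫χB^Ξ_r − η) ≤ δ` for ALL `0 < r < 1/8` and ALL `N`.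
The new input versus `GAfterR` is an `r`-UNIFORM bound on the SPACE INTEGRAL of the pair functional by HARD-CORE PACKING: on the
hard-sphere domain (centres pairwise `≥ ε` apart, `(N+1)ε³ = σ³`) at most `(2r/ε + 1)³` centres lie within `r` of any point
(`card_le_of_separated` on minimal images), so either `2r < ε` and the off-diagonal part of `B_r` vanishes (the diagonal carries
`Θ(v,v) = 0`), or `Σ_j b_r(x_j, x₀) ≤ 192/(πε³)` and `B_r Ξ(z, x₀) ≤ (N+1)⁻² · 2C|S²| · 192/(πε³) · Σ_i ‖v_i‖ b_r(x_i, x₀)`;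
integrating (`∫ b_r = 1`) and using `(N+1)ε³ = σ³`: `σ³ ∫ χ B_r ≤ ‖χ‖ (384 C|S²|/π) (½ + E(z)/(N+1))`, uniformly in `r` and `N`.
Energy conservation along good orbits, nonnegativity of the collision functional and Markov under `E_{LG_N}[E] ≤ A(N+1)`
(`exists_localGibbsLaw_dominated`) finish as in `GAfterR`.  Hence the planner must keep `∃ g₀` BEFORE `∀ η`.
prover-line-stmt-AtomisticToContinuum-13080-c4-0.
-/

noncomputable section

open scoped BigOperators Topology ENNReal NNReal InnerProductSpace RealInnerProductSpace Classical
open MeasureTheory Set Filter Function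
open Literature.Analysis.FluidPDE Literature.MathematicalPhysics.KineticTheory
open Summit.AtomisticToContinuum.HydrodynamicLimit.Theses.JParityClosure

namespace Summit.AtomisticToContinuum.HydrodynamicLimit.Theorems.RateFloorGAfterEta

open Summit.AtomisticToContinuum.HydrodynamicLimit.Theorems.RateFloorPairFunctionalUpper
open Summit.AtomisticToContinuum.HydrodynamicLimit.Theorems.EvenStressEnskog
open Summit.AtomisticToContinuum.HydrodynamicLimit.Theorems.RateFloorGAfterR (exists_bound_on_slab kc_nonneg event_arith)

/-- The cone kernel vanishes outside the ball of radius `r`. [folklore] -/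
theorem coneKernel_eq_zero_of_le {r : ℝ} (hr : 0 < r) {x x₀ : T3} (h : r ≤ Torus.euclidDist x x₀) :
    coneKernel r x x₀ = 0 := by
  unfold coneKernel
  rw [max_eq_right (by rw [sub_nonpos, le_div_iff₀ hr, one_mul]; exact h), mul_zero]

/-- **Hard-core packing on the torus**: in the hard-sphere domain at diameter `ε > 0`, at most `(2r/ε + 1)³` centres lie within
minimal-image distance `< r` of a given point (their minimal images are pairwise `≥ ε` apart: `card_le_of_separated`,
`Torus.norm_reprSym_proj_le`). [folklore] -/
theorem card_near_le {N : ℕ} {ε r : ℝ} (hε : 0 < ε) (hr : 0 < r) {z : Config (N + 1) (Fin 3) T3}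
    (hz : z ∈ hardSphereDomain (Torus.geometry (Fin 3)) (N + 1) ε) (x₀ : T3) :
    (((Finset.univ.filter fun j : Fin (N + 1) => Torus.euclidDist (z j).1 x₀ < r).card : ℕ) : ℝ) ≤
      (2 * r / ε + 1) ^ 3 := by
  set s := Finset.univ.filter fun j : Fin (N + 1) => Torus.euclidDist (z j).1 x₀ < r with hs
  have hR : ∀ j ∈ s, ‖Torus.reprSym ((z j).1 - x₀)‖ ≤ r := fun j hj => le_of_lt (Finset.mem_filter.1 hj).2
  have hsep : ∀ j ∈ s, ∀ j' ∈ s, j ≠ j' → ε ≤ ‖Torus.reprSym ((z j).1 - x₀) - Torus.reprSym ((z j').1 - x₀)‖ := by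
    intro j _ j' _ hne
    have hproj : Literature.Analysis.FunctionSpaces.Torus.proj
        (Torus.reprSym ((z j).1 - x₀) - Torus.reprSym ((z j').1 - x₀)) = (z j).1 - (z j').1 := by
      rw [sub_eq_add_neg, Literature.Analysis.FunctionSpaces.Torus.proj_add,
        Literature.Analysis.FunctionSpaces.Torus.proj_neg, Torus.proj_reprSym, Torus.proj_reprSym]
      abel
    have hmin := Torus.norm_reprSym_proj_le (Torus.reprSym ((z j).1 - x₀) - Torus.reprSym ((z j').1 - x₀))
    rw [hproj] at hmin
    have hcore := mem_hardSphereDomain.1 hz j j' hne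
    rw [Torus.geometry_sepVec] at hcore
    exact hcore.trans hmin
  exact card_le_of_separated s (fun j => Torus.reprSym ((z j).1 - x₀)) hε hr.le hR hsep

/-- **Dense mollifier**: if `ε ≤ 2r` then, on the hard-sphere domain, `Σ_j b_r(x_j, x₀) ≤ 3/(πr³) · (4r/ε)³ = 192/(πε³)`. [folklore] -/
theorem sum_coneKernel_le {N : ℕ} {ε r : ℝ} (hε : 0 < ε) (hr : 0 < r) (hεr : ε ≤ 2 * r) {z : Config (N + 1) (Fin 3) T3}
    (hz : z ∈ hardSphereDomain (Torus.geometry (Fin 3)) (N + 1) ε) (x₀ : T3) :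
    ∑ j, coneKernel r (z j).1 x₀ ≤ 192 / (Real.pi * ε ^ 3) := by
  have hM0 : 0 ≤ 3 / (Real.pi * r ^ 3) := by positivity
  have h1 : ∀ j, coneKernel r (z j).1 x₀ ≤ 3 / (Real.pi * r ^ 3) * (if Torus.euclidDist (z j).1 x₀ < r then 1 else 0) := by
    intro j
    split_ifs with h
    · rw [mul_one]; exact (coneKernel_nonneg_le hr _ _).2
    · rw [mul_zero, coneKernel_eq_zero_of_le hr (not_lt.1 h)]
  have h3 : (2 * r / ε + 1) ^ 3 ≤ (4 * r / ε) ^ 3 := by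
    have h1le : 1 ≤ 2 * r / ε := by rw [le_div_iff₀ hε, one_mul]; exact hεr
    have h4 : 4 * r / ε = 2 * r / ε + 2 * r / ε := by ring
    exact pow_le_pow_left₀ (by positivity) (by linarith) 3
  have hr0 : r ≠ 0 := hr.ne'
  have hε0 : ε ≠ 0 := hε.ne'
  calc ∑ j, coneKernel r (z j).1 x₀ ≤ ∑ j, 3 / (Real.pi * r ^ 3) * (if Torus.euclidDist (z j).1 x₀ < r then 1 else 0) :=
        Finset.sum_le_sum fun j _ => h1 j
    _ = 3 / (Real.pi * r ^ 3) * ((Finset.univ.filter fun j : Fin (N + 1) => Torus.euclidDist (z j).1 x₀ < r).card : ℝ) := by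
        rw [← Finset.mul_sum, Finset.sum_boole]
    _ ≤ 3 / (Real.pi * r ^ 3) * (2 * r / ε + 1) ^ 3 := mul_le_mul_of_nonneg_left (card_near_le hε hr hz x₀) hM0
    _ ≤ 3 / (Real.pi * r ^ 3) * (4 * r / ε) ^ 3 := mul_le_mul_of_nonneg_left h3 hM0
    _ = 192 / (Real.pi * ε ^ 3) := by field_simp; ring

/-- **`r`-uniform pointwise packing bound on the pair functional** on the hard-sphere domain (`0 ≤ Ξ ≤ C`):
`B_r Ξ (z, x₀) ≤ (N+1)⁻² · 2C|S²| · 192/(πε³) · Σ_i ‖v_i‖ b_r(x_i, x₀)` — if `2r < ε` every term of the double sum vanishes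
(hard core + `Θ(v,v) = 0`), otherwise `Θ Ξ v w ≤ C|S²|(‖v‖ + ‖w‖)` and the dense-mollifier bound. [folklore] -/
theorem pairFunctional_le_packing {N : ℕ} {ε r : ℝ} (hε : 0 < ε) (hr : 0 < r) {Ξ : V3 × V3 × V3 → ℝ} (hΞ : Continuous Ξ)
    (hΞ0 : ∀ q, 0 ≤ Ξ q) {C : ℝ} (hΞC : ∀ q, Ξ q ≤ C) {z : Config (N + 1) (Fin 3) T3}
    (hz : z ∈ hardSphereDomain (Torus.geometry (Fin 3)) (N + 1) ε) (x₀ : T3) :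
    pairFunctional r Ξ z x₀ ≤ ((N + 1 : ℕ) : ℝ)⁻¹ * ((N + 1 : ℕ) : ℝ)⁻¹ *
      (2 * (C * (sphereMeasure : Measure (Metric.sphere (0 : V3) 1)).real univ) * (192 / (Real.pi * ε ^ 3))) *
        ∑ i, ‖(z i).2‖ * coneKernel r (z i).1 x₀ := by
  haveI := isFiniteMeasure_sphereMeasure (E := V3)
  set K : ℝ := C * (sphereMeasure : Measure (Metric.sphere (0 : V3) 1)).real univ with hK
  have hC0 : 0 ≤ C := (hΞ0 0).trans (hΞC 0)
  have hK0 : 0 ≤ K := mul_nonneg hC0 measureReal_nonneg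
  have hb0 : ∀ i, 0 ≤ coneKernel r (z i).1 x₀ := fun i => (coneKernel_nonneg_le hr _ _).1
  have hT0 : 0 ≤ ∑ i, ‖(z i).2‖ * coneKernel r (z i).1 x₀ :=
    Finset.sum_nonneg fun i _ => mul_nonneg (norm_nonneg _) (hb0 i)
  rw [pairFunctional_eq_sum, mul_assoc (((N + 1 : ℕ) : ℝ)⁻¹ * ((N + 1 : ℕ) : ℝ)⁻¹)]
  refine mul_le_mul_of_nonneg_left ?_ (by positivity)
  rcases le_or_gt ε (2 * r) with hεr | hεr
  · -- dense mollifier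
    have hS : ∑ j, coneKernel r (z j).1 x₀ ≤ 192 / (Real.pi * ε ^ 3) := sum_coneKernel_le hε hr hεr hz x₀
    have hterm : ∀ i j, coneKernel r (z i).1 x₀ * coneKernel r (z j).1 x₀ * sphereMark Ξ (z i).2 (z j).2 ≤
        K * ((‖(z i).2‖ * coneKernel r (z i).1 x₀) * coneKernel r (z j).1 x₀ +
          coneKernel r (z i).1 x₀ * (‖(z j).2‖ * coneKernel r (z j).1 x₀)) := by
      intro i j
      have h1 := sphereMark_le_mul_norm hΞ hΞ0 hΞC (z i).2 (z j).2
      have h2 : ‖(z j).2 - (z i).2‖ ≤ ‖(z i).2‖ + ‖(z j).2‖ := (norm_sub_le _ _).trans (add_comm _ _).le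
      have h3 : sphereMark Ξ (z i).2 (z j).2 ≤ K * (‖(z i).2‖ + ‖(z j).2‖) := h1.trans (mul_le_mul_of_nonneg_left h2 hK0)
      calc coneKernel r (z i).1 x₀ * coneKernel r (z j).1 x₀ * sphereMark Ξ (z i).2 (z j).2
          ≤ coneKernel r (z i).1 x₀ * coneKernel r (z j).1 x₀ * (K * (‖(z i).2‖ + ‖(z j).2‖)) :=
            mul_le_mul_of_nonneg_left h3 (mul_nonneg (hb0 i) (hb0 j))
        _ = _ := by ring
    calc ∑ i, ∑ j, coneKernel r (z i).1 x₀ * coneKernel r (z j).1 x₀ * sphereMark Ξ (z i).2 (z j).2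
        ≤ ∑ i, ∑ j, K * ((‖(z i).2‖ * coneKernel r (z i).1 x₀) * coneKernel r (z j).1 x₀ +
            coneKernel r (z i).1 x₀ * (‖(z j).2‖ * coneKernel r (z j).1 x₀)) :=
          Finset.sum_le_sum fun i _ => Finset.sum_le_sum fun j _ => hterm i j
      _ = K * ((∑ i, ‖(z i).2‖ * coneKernel r (z i).1 x₀) * (∑ j, coneKernel r (z j).1 x₀) +
            (∑ i, coneKernel r (z i).1 x₀) * (∑ j, ‖(z j).2‖ * coneKernel r (z j).1 x₀)) := by
          rw [Finset.sum_mul_sum, Finset.sum_mul_sum, ← Finset.sum_add_distrib, Finset.mul_sum]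
          refine Finset.sum_congr rfl fun i _ => ?_
          rw [← Finset.sum_add_distrib, Finset.mul_sum]
      _ = 2 * K * (∑ j, coneKernel r (z j).1 x₀) * (∑ i, ‖(z i).2‖ * coneKernel r (z i).1 x₀) := by ring
      _ ≤ 2 * K * (192 / (Real.pi * ε ^ 3)) * (∑ i, ‖(z i).2‖ * coneKernel r (z i).1 x₀) :=
          mul_le_mul_of_nonneg_right (mul_le_mul_of_nonneg_left hS (mul_nonneg zero_le_two hK0)) hT0
      _ = 2 * K * (192 / (Real.pi * ε ^ 3)) * ∑ i, ‖(z i).2‖ * coneKernel r (z i).1 x₀ := rfl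
  · -- sparse mollifier: every term vanishes
    have hzero : ∀ i j, coneKernel r (z i).1 x₀ * coneKernel r (z j).1 x₀ * sphereMark Ξ (z i).2 (z j).2 = 0 := by
      intro i j
      by_cases hij : i = j
      · subst hij; rw [sphereMark_diag, mul_zero]
      · have hcore : ε ≤ Torus.euclidDist (z i).1 (z j).1 := mem_hardSphereDomain.1 hz i j hij
        by_cases hi : Torus.euclidDist (z i).1 x₀ < r
        · have hj : r ≤ Torus.euclidDist (z j).1 x₀ := by
            by_contra hj'
            have htri := euclidDist_triangle' (z i).1 x₀ (z j).1
            rw [Torus.euclidDist_comm x₀] at htri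
            linarith [not_le.1 hj']
          rw [coneKernel_eq_zero_of_le hr hj, mul_zero, zero_mul]
        · rw [coneKernel_eq_zero_of_le hr (not_lt.1 hi), zero_mul, zero_mul]
    rw [Finset.sum_eq_zero fun i _ => Finset.sum_eq_zero fun j _ => hzero i j]
    exact mul_nonneg (mul_nonneg (mul_nonneg zero_le_two hK0) (by positivity)) hT0

/-- **`r`-uniform bound on the weighted space integral of the pair functional** on the hard-sphere domain (`0 ≤ w ≤ M_w`,
`0 < r < 1/2`, `∫ b_r(x, ·) = 1`): `∫ w B_r Ξ(z, ·) ≤ M_w · (N+1)⁻² · 2C|S²| · 192/(πε³) · Σ_i ‖v_i‖`. [folklore] -/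
theorem integral_mul_pairFunctional_le {N : ℕ} {ε r : ℝ} (hε : 0 < ε) (hr : 0 < r) (hr2 : r < 1 / 2)
    {Ξ : V3 × V3 × V3 → ℝ} (hΞ : Continuous Ξ) (hΞ0 : ∀ q, 0 ≤ Ξ q) {C : ℝ} (hΞC : ∀ q, Ξ q ≤ C)
    {z : Config (N + 1) (Fin 3) T3} (hz : z ∈ hardSphereDomain (Torus.geometry (Fin 3)) (N + 1) ε)
    {w : T3 → ℝ} {Mw : ℝ} (hMw : 0 ≤ Mw) (hw0 : ∀ x, 0 ≤ w x) (hw : ∀ x, w x ≤ Mw) :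
    ∫ x, w x * pairFunctional r Ξ z x ≤ Mw * (((N + 1 : ℕ) : ℝ)⁻¹ * ((N + 1 : ℕ) : ℝ)⁻¹ *
      (2 * (C * (sphereMeasure : Measure (Metric.sphere (0 : V3) 1)).real univ) * (192 / (Real.pi * ε ^ 3)))) *
        ∑ i, ‖(z i).2‖ := by
  set c : ℝ := ((N + 1 : ℕ) : ℝ)⁻¹ * ((N + 1 : ℕ) : ℝ)⁻¹ *
      (2 * (C * (sphereMeasure : Measure (Metric.sphere (0 : V3) 1)).real univ) * (192 / (Real.pi * ε ^ 3))) with hc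
  have hKc : ∀ i, Continuous fun x : T3 => ‖(z i).2‖ * coneKernel r (z i).1 x := fun i =>
    continuous_const.mul (continuous_coneKernel_comp r continuous_const continuous_id)
  have hKi : ∀ i, Integrable (fun x : T3 => ‖(z i).2‖ * coneKernel r (z i).1 x) := fun i =>
    (hKc i).integrable_of_hasCompactSupport (HasCompactSupport.of_compactSpace _)
  have hgc : Continuous fun x : T3 => Mw * (c * ∑ i, ‖(z i).2‖ * coneKernel r (z i).1 x) :=
    continuous_const.mul (continuous_const.mul (continuous_finsetSum _ fun i _ => hKc i))
  have hgi : Integrable (fun x : T3 => Mw * (c * ∑ i, ‖(z i).2‖ * coneKernel r (z i).1 x)) :=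
    hgc.integrable_of_hasCompactSupport (HasCompactSupport.of_compactSpace _)
  have hle : ∀ x, w x * pairFunctional r Ξ z x ≤ Mw * (c * ∑ i, ‖(z i).2‖ * coneKernel r (z i).1 x) := fun x =>
    mul_le_mul (hw x) (pairFunctional_le_packing hε hr hΞ hΞ0 hΞC hz x) (pairFunctional_nonneg hr hΞ0 z x) hMw
  have hmono : ∫ x, w x * pairFunctional r Ξ z x ≤ ∫ x, Mw * (c * ∑ i, ‖(z i).2‖ * coneKernel r (z i).1 x) :=
    integral_mono_of_nonneg (Eventually.of_forall fun x => mul_nonneg (hw0 x) (pairFunctional_nonneg hr hΞ0 z x)) hgi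
      (Eventually.of_forall hle)
  have hone : ∀ i, ∫ x, ‖(z i).2‖ * coneKernel r (z i).1 x = ‖(z i).2‖ := fun i => by
    have e : (fun x => ‖(z i).2‖ * coneKernel r (z i).1 x) = fun x => ‖(z i).2‖ * coneKernel r x (z i).1 :=
      funext fun x => by unfold coneKernel; rw [Torus.euclidDist_comm]
    rw [e, integral_const_mul, integral_coneKernel hr hr2, mul_one]
  have hgI : ∫ x, Mw * (c * ∑ i, ‖(z i).2‖ * coneKernel r (z i).1 x) = Mw * (c * ∑ i, ‖(z i).2‖) := by
    rw [integral_const_mul, integral_const_mul, integral_finsetSum _ fun i _ => hKi i]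
    simp only [hone]
  rw [hgI] at hmono
  exact hmono.trans (le_of_eq (mul_assoc _ _ _).symm)

/-- `Σ_i ‖v_i‖ ≤ (N+1)/2 + E(z)` (`‖v‖ ≤ ½ + ½‖v‖²`). [folklore] -/
theorem sum_norm_le_energy {N : ℕ} (z : Config (N + 1) (Fin 3) T3) :
    ∑ i, ‖(z i).2‖ ≤ ((N + 1 : ℕ) : ℝ) / 2 + configEnergy z := by
  have h1 : ∀ i, ‖(z i).2‖ ≤ 1 / 2 + 2⁻¹ * ‖(z i).2‖ ^ 2 := fun i => by nlinarith [sq_nonneg (‖(z i).2‖ - 1)]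
  calc ∑ i, ‖(z i).2‖ ≤ ∑ i, (1 / 2 + 2⁻¹ * ‖(z i).2‖ ^ 2) := Finset.sum_le_sum fun i _ => h1 i
    _ = ((N + 1 : ℕ) : ℝ) / 2 + configEnergy z := by
        rw [Finset.sum_add_distrib, Finset.sum_const, Finset.card_univ, Fintype.card_fin, ← Finset.mul_sum, configEnergy]
        rw [nsmul_eq_mul]
        ring

/-- **Along a good orbit the weighted space-time integral of the pair functional is bounded uniformly in `r` and `N`**:
`σ³ ∫₀^τ ∫ χ B_r Ξ(Φ_s z, ·) ≤ τ‖χ‖(384 C|S²|/π)(½ + E(z)/(N+1))` for `0 < r < 1/2` (packing bound `integral_mul_pairFunctional_le` on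
the hard-sphere domain `⊇ Φ_s(good)`, `Σ‖v_i(s)‖ ≤ (N+1)/2 + E(Φ_s z) = (N+1)/2 + E(z)`, and `(N+1)ε³ = σ³`). [folklore] -/
theorem orbit_bound {N : ℕ} {σ r τ Mχ C : ℝ} (hσ : 0 < σ) (hr : 0 < r) (hr2 : r < 1 / 2) (hτ : 0 < τ)
    {Ξ : V3 × V3 × V3 → ℝ} (hΞ : Continuous Ξ) (hΞ0 : ∀ q, 0 ≤ Ξ q) (hΞC : ∀ q, Ξ q ≤ C)
    (Φ : HardSphereFlow (Torus.geometry (Fin 3)) (hsDiameter σ N) (N + 1)) {z : Config (N + 1) (Fin 3) T3} (hz : z ∈ Φ.good)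
    {χ : ℝ × T3 → ℝ} (hχ0 : ∀ p, 0 ≤ χ p) (hMχ0 : 0 ≤ Mχ) (hMχ : ∀ u ∈ Set.Icc (0 : ℝ) τ, ∀ x, |χ (u, x)| ≤ Mχ) :
    σ ^ 3 * ∫ s in Set.Icc (0 : ℝ) τ, ∫ x : T3, χ (s, x) * pairFunctional r Ξ (Φ.flow s z) x ≤
      τ * (Mχ * (384 * (C * (sphereMeasure : Measure (Metric.sphere (0 : V3) 1)).real univ) / Real.pi)) / 2 +
        τ * (Mχ * (384 * (C * (sphereMeasure : Measure (Metric.sphere (0 : V3) 1)).real univ) / Real.pi)) *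
          ((((N + 1 : ℕ) : ℝ))⁻¹ * configEnergy z) := by
  haveI := isFiniteMeasure_sphereMeasure (E := V3)
  set K : ℝ := C * (sphereMeasure : Measure (Metric.sphere (0 : V3) 1)).real univ with hK
  have hC0 : 0 ≤ C := (hΞ0 0).trans (hΞC 0)
  have hK0 : 0 ≤ K := by rw [hK]; exact mul_nonneg hC0 measureReal_nonneg
  have hε : 0 < hsDiameter σ N := hsDiameter_pos hσ N
  have hcube : ((N + 1 : ℕ) : ℝ) * hsDiameter σ N ^ 3 = σ ^ 3 := succ_mul_hsDiameter_pow_three σ N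
  have hn' : (0 : ℝ) < ((N + 1 : ℕ) : ℝ) := by positivity
  set e : ℝ := (((N + 1 : ℕ) : ℝ))⁻¹ * configEnergy z with he
  have hzs : ∀ s, Φ.flow s z ∈ hardSphereDomain (Torus.geometry (Fin 3)) (N + 1) (hsDiameter σ N) := fun s =>
    Φ.good_subset (Φ.mapsTo_good s hz)
  have hIx : ∀ s ∈ Set.Icc (0 : ℝ) τ, ∫ x : T3, χ (s, x) * pairFunctional r Ξ (Φ.flow s z) x ≤
      Mχ * (((N + 1 : ℕ) : ℝ)⁻¹ * ((N + 1 : ℕ) : ℝ)⁻¹ * (2 * K * (192 / (Real.pi * hsDiameter σ N ^ 3)))) *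
        ∑ i, ‖(Φ.flow s z i).2‖ := fun s hs =>
    integral_mul_pairFunctional_le hε hr hr2 hΞ hΞ0 hΞC (hzs s) hMχ0 (fun x => hχ0 _)
      (fun x => (le_abs_self _).trans (hMχ s hs x))
  have hD : ∀ s ∈ Set.Icc (0 : ℝ) τ, ∫ x : T3, χ (s, x) * pairFunctional r Ξ (Φ.flow s z) x ≤
      Mχ * (384 * K / Real.pi) * (1 / 2 + e) / σ ^ 3 := by
    intro s hs
    refine (hIx s hs).trans ?_
    have h1 : ∑ i, ‖(Φ.flow s z i).2‖ ≤ ((N + 1 : ℕ) : ℝ) / 2 + configEnergy z := by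
      rw [← Φ.configEnergy_flow hz s]; exact sum_norm_le_energy _
    have hcoef : 0 ≤ Mχ * (((N + 1 : ℕ) : ℝ)⁻¹ * ((N + 1 : ℕ) : ℝ)⁻¹ * (2 * K * (192 / (Real.pi * hsDiameter σ N ^ 3)))) :=
      mul_nonneg hMχ0 (mul_nonneg (by positivity) (mul_nonneg (mul_nonneg zero_le_two hK0) (by positivity)))
    refine (mul_le_mul_of_nonneg_left h1 hcoef).trans (le_of_eq ?_)
    rw [he, ← hcube]
    have hε0 : hsDiameter σ N ≠ 0 := hε.ne'
    have hn0 : ((N + 1 : ℕ) : ℝ) ≠ 0 := hn'.ne'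
    field_simp
    ring
  have hF0 : ∀ s, 0 ≤ ∫ x : T3, χ (s, x) * pairFunctional r Ξ (Φ.flow s z) x := fun s =>
    integral_nonneg fun x => mul_nonneg (hχ0 _) (pairFunctional_nonneg hr hΞ0 _ _)
  have hx : ∀ s ∈ Set.Icc (0 : ℝ) τ, ‖∫ x : T3, χ (s, x) * pairFunctional r Ξ (Φ.flow s z) x‖ ≤
      Mχ * (384 * K / Real.pi) * (1 / 2 + e) / σ ^ 3 := fun s hs => by
    rw [Real.norm_eq_abs, abs_of_nonneg (hF0 s)]; exact hD s hs
  have hI : ∫ s in Set.Icc (0 : ℝ) τ, ∫ x : T3, χ (s, x) * pairFunctional r Ξ (Φ.flow s z) x ≤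
      Mχ * (384 * K / Real.pi) * (1 / 2 + e) / σ ^ 3 * τ := by
    have h1 : ∀ᵐ s ∂(volume.restrict (Set.Icc (0 : ℝ) τ)), ‖∫ x : T3, χ (s, x) * pairFunctional r Ξ (Φ.flow s z) x‖ ≤
        Mχ * (384 * K / Real.pi) * (1 / 2 + e) / σ ^ 3 := (ae_restrict_iff' measurableSet_Icc).2 (Eventually.of_forall hx)
    have h2 := norm_integral_le_of_norm_le_const h1
    rw [measureReal_restrict_apply_univ, Real.volume_real_Icc_of_le hτ.le, sub_zero] at h2
    exact (le_abs_self _).trans (Real.norm_eq_abs _ ▸ h2)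
  have h1 := mul_le_mul_of_nonneg_left hI (pow_pos hσ 3).le
  have h2 : σ ^ 3 * (Mχ * (384 * K / Real.pi) * (1 / 2 + e) / σ ^ 3 * τ) =
      τ * (Mχ * (384 * K / Real.pi)) / 2 + τ * (Mχ * (384 * K / Real.pi)) * e := by
    field_simp
  linarith

/-- **`RateFloor` WITH THE FLOOR CONSTANT AFTER THE SLACK `η` (BUT BEFORE `r`, `N`) IS JUNK-TRUE** (registered stub
`stub_rateFloorGAfterEta` of line `Sketch`; quantifier-order record, not a step of the crux proof).  For every continuous positive
local Gibbs datum, `0 < σ ≤ 1/2`, flows, `τ > 0`, continuous `χ ≥ 0`, bounded continuous `Ξ ≥ 0`, `η, δ > 0` there is `g₀ > 0` with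
`LG_N(K_N[χΞ] < g₀σ³∫₀^τ∫χB^Ξ_r − η) ≤ δ` for ALL `0 < r < 1/8` and ALL `N`: hard-core packing bounds `σ³∫χB^Ξ_r` along good orbits by
`τ‖χ‖(384 C|S²|/π)(½ + E(z)/(N+1))` uniformly in `r`, the collision functional is `≥ 0`, and `E_{LG_N}[E] ≤ A(N+1)` (Markov).
[folklore] -/
theorem stub_rateFloorGAfterEta :
    ∀ (a₀ θ₀ : Literature.MathematicalPhysics.KineticTheory.T3 → ℝ) (u₀ : Literature.MathematicalPhysics.KineticTheory.T3 → Literature.MathematicalPhysics.KineticTheory.V3), Continuous a₀ → Continuous θ₀ → Continuous u₀ → (∀ x, 0 < a₀ x) → (∀ x, 0 < θ₀ x) → ∀ σ : ℝ, 0 < σ → σ ≤ 1 / 2 → ∀ Φ : (N : ℕ) → Literature.Analysis.FluidPDE.HardSphereFlow (Literature.Analysis.FluidPDE.Torus.geometry (Fin 3)) (Literature.MathematicalPhysics.KineticTheory.hsDiameter σ N) (N + 1), ∀ τ : ℝ, 0 < τ → ∀ χ : ℝ × UnitAddTorus (Fin 3) → ℝ, Continuous χ → (∀ p, 0 ≤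 χ p) → ∀ Ξ : EuclideanSpace ℝ (Fin 3) × EuclideanSpace ℝ (Fin 3) × EuclideanSpace ℝ (Fin 3) → ℝ, Continuous Ξ → (∀ q, 0 ≤ Ξ q) → (∃ C : ℝ, ∀ q, Ξ q ≤ C) → ∀ η δ : ℝ, 0 < η → 0 < δ → ∃ g₀ : ℝ, 0 < g₀ ∧ ∀ r : ℝ, 0 < r → r < 1 / 8 → ∀ N : ℕ, let ε := Literature.MathematicalPhysics.KineticTheory.hsDiameter σ N; let G := Literature.Analysis.FluidPDE.Torus.geometry (Fin 3); let γ := fun z (s : ℝ) => (Φ N).flow s z; let bx : UnitAddTorus (Fin 3) → UnitAddTorus (Fin 3) → ℝ := fun x y => 3 / (Real.pi * r ^ 3) * max (1 - Literature.Analysis.FluidPDE.Torus.euclidDist x y / r) 0; let Θ := fun (Ξ : EuclideanSpace ℝ (Fin 3) × EuclideanSpace ℝ (Fin 3) × EuclideanSpace ℝ (Fin 3) → ℝ) (v w : EuclideanSpace ℝ (Fin 3)) => ∫ ω : Metric.sphere (0 : EuclideanSpace ℝ (Fin 3)) 1, Ξ ((ω : EuclideanSpace ℝ (Fin 3)), v,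 w) * Literature.MathematicalPhysics.KineticTheory.hardSphereKernel (w, v) ω ∂Literature.MathematicalPhysics.KineticTheory.sphereMeasure; let B := fun Ξ z s (x₀ : UnitAddTorus (Fin 3)) => ∫ p, bx p.1.1 x₀ * bx p.2.1 x₀ * Θ Ξ p.1.2 p.2.2 ∂((Literature.Analysis.FluidPDE.empiricalMeasure (γ z s)).prod (Literature.Analysis.FluidPDE.empiricalMeasure (γ z s))); let pv := fun z s (i j : Fin (N + 1)) => Literature.Analysis.FluidPDE.reflectVel (G.sepVec (γ z s i).1 (γ z s j).1) ((γ z s i).2, (γ z s j).2); let Kc := fun (Fn : Literature.Analysis.FluidPDE.Config (N + 1) (Fin 3) Literature.MathematicalPhysics.KineticTheory.T3 → ℝ → Fin (N + 1) → Fin (N + 1) → ℝ) z => ε / (N + 1 : ℝ) * ∑ᶠ (s : ℝ) (_ : s ∈ Literature.Analysis.FluidPDE.collisionTimes G ε (γ z) ∩ Set.Icc 0 τ), ∑ i : Fin (N + 1), ∑ j : Fin (N + 1), (if i ≠ j ∧ ‖G.sepVec (γ z s i).1 (γ z s j).1‖ = ε then Fn z s i j else 0); Literature.MathematicalPhysics.KineticTheory.localGibbsLaw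 σ a₀ u₀ θ₀ N (Φ N) {z | Kc (fun z s i j => χ (s, (γ z s i).1) * Ξ (ε⁻¹ • G.sepVec (γ z s i).1 (γ z s j).1, (pv z s i j).1, (pv z s i j).2)) z < g₀ * σ ^ 3 * (∫ s in Set.Icc (0 : ℝ) τ, ∫ x : UnitAddTorus (Fin 3), χ (s, x) * B Ξ z s x) - η} ≤ ENNReal.ofReal δ := by
  intro a₀ θ₀ u₀ ha hθ hu ha0 hθ0 σ hσ hσ2 Φ τ hτ χ hχc hχ0 Ξ hΞc hΞ0 hΞC η δ hη hδ
  haveI := isFiniteMeasure_sphereMeasure (E := V3)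
  obtain ⟨C, hC⟩ := hΞC
  obtain ⟨Mχ, hMχ0, hMχ⟩ := exists_bound_on_slab χ hχc τ
  obtain ⟨A, bb, hA, hbb, hdom⟩ :=
    Summit.AtomisticToContinuum.HydrodynamicLimit.Theorems.LambertianContactSwapSwapGapGibbsDomination.exists_localGibbsLaw_dominated
      ha hθ hu ha0 hθ0 hσ2
  set K : ℝ := C * (sphereMeasure : Measure (Metric.sphere (0 : V3) 1)).real univ with hK
  have hC0 : 0 ≤ C := (hΞ0 0).trans (hC 0)
  have hK0 : 0 ≤ K := by rw [hK]; exact mul_nonneg hC0 measureReal_nonneg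
  set a : ℝ := τ * (Mχ * (384 * K / Real.pi)) / 2 with ha_def
  set b : ℝ := τ * (Mχ * (384 * K / Real.pi)) with hb_def
  have ha0' : 0 ≤ a := by positivity
  have hb0' : 0 ≤ b := by positivity
  -- the floor constant: depends on η, δ, A, τ, ‖χ‖, C only
  set g₀ : ℝ := min (η / (2 * (a + 1))) (η * δ / (2 * (A + 1) * (b + 1))) with hg₀
  have hg₀pos : 0 < g₀ := lt_min (by positivity) (by positivity)
  refine ⟨g₀, hg₀pos, fun r hr hr8 N => ?_⟩
  intro ε G γ bx Θ B pv Kc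
  set P := Literature.MathematicalPhysics.KineticTheory.localGibbsLaw σ a₀ u₀ θ₀ N (Φ N) with hP
  haveI : IsProbabilityMeasure P := isProbabilityMeasure_localGibbsLaw ha hθ hu ha0 hθ0 hσ2 N (Φ N)
  obtain ⟨-, -, -, hEint, hEle⟩ := hdom N (Φ N)
  have hn : (0 : ℝ) < (N : ℝ) + 1 := by positivity
  have hε : 0 < ε := hsDiameter_pos hσ N
  have hr2 : r < 1 / 2 := by linarith
  set T : ℝ := (A + 1) * ((N : ℝ) + 1) / δ with hT
  have hTpos : 0 < T := by positivity
  have hgood : P (Φ N).goodᶜ = 0 := by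
    rw [hP, Literature.MathematicalPhysics.KineticTheory.localGibbsLaw, particleLaw_eq]
    exact withDensity_absolutelyContinuous _ _ (Φ N).measure_compl_good
  -- the event forces a large kinetic energy on good points
  have hsub : {z | Kc (fun z s i j => χ (s, (γ z s i).1) *
        Ξ (ε⁻¹ • G.sepVec (γ z s i).1 (γ z s j).1, (pv z s i j).1, (pv z s i j).2)) z <
        g₀ * σ ^ 3 * (∫ s in Set.Icc (0 : ℝ) τ, ∫ x : UnitAddTorus (Fin 3), χ (s, x) * B Ξ z s x) - η} ⊆
      {z | T ≤ configEnergy z} ∪ (Φ N).goodᶜ := by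
    intro z hz
    by_cases hzg : z ∈ (Φ N).good
    swap
    · exact Or.inr hzg
    left
    have hz' : Kc (fun z s i j => χ (s, (γ z s i).1) *
        Ξ (ε⁻¹ • G.sepVec (γ z s i).1 (γ z s j).1, (pv z s i j).1, (pv z s i j).2)) z <
        g₀ * σ ^ 3 * (∫ s in Set.Icc (0 : ℝ) τ, ∫ x : UnitAddTorus (Fin 3), χ (s, x) * B Ξ z s x) - η := hz
    -- (1) the collision functional is nonnegative
    have hK0' : 0 ≤ Kc (fun z s i j => χ (s, (γ z s i).1) *
        Ξ (ε⁻¹ • G.sepVec (γ z s i).1 (γ z s j).1, (pv z s i j).1, (pv z s i j).2)) z := by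
      refine kc_nonneg (div_nonneg hε.le hn.le) _ _ _ fun s i j => ?_
      exact mul_nonneg (hχ0 _) (hΞ0 _)
    -- (2) r-uniform packing bound on σ³ ∫∫ χ B along the good (hard-core, energy-conserving) orbit
    have hE0 : 0 ≤ configEnergy z := by
      unfold configEnergy; exact mul_nonneg (by norm_num) (Finset.sum_nonneg fun i _ => sq_nonneg _)
    set e : ℝ := (((N + 1 : ℕ) : ℝ))⁻¹ * configEnergy z with he
    have he0 : 0 ≤ e := by positivity
    have hI' : σ ^ 3 * ∫ s in Set.Icc (0 : ℝ) τ, ∫ x : UnitAddTorus (Fin 3), χ (s, x) * B Ξ z s x ≤ a + b * e :=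
      orbit_bound hσ hr hr2 hτ hΞc hΞ0 hC (Φ N) hzg hχ0 hMχ0 hMχ
    -- (3) arithmetic: η/2 < g₀ b e, hence e > (A+1)/δ
    have hga : g₀ * a ≤ η / 2 := by
      have h1 : g₀ ≤ η / (2 * (a + 1)) := min_le_left _ _
      have h2 : g₀ * (a + 1) ≤ η / 2 := by
        rw [le_div_iff₀ (by positivity)] at h1; nlinarith
      nlinarith [mul_nonneg hg₀pos.le ha0']
    have hz2 : Kc (fun z s i j => χ (s, (γ z s i).1) *
        Ξ (ε⁻¹ • G.sepVec (γ z s i).1 (γ z s j).1, (pv z s i j).1, (pv z s i j).2)) z <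
        g₀ * (σ ^ 3 * ∫ s in Set.Icc (0 : ℝ) τ, ∫ x : UnitAddTorus (Fin 3), χ (s, x) * B Ξ z s x) - η := by
      rw [← mul_assoc]; exact hz'
    have hkey := event_arith hK0' hz2 hg₀pos.le hI' hga
    have hgb : g₀ * b ≤ η * δ / (2 * (A + 1)) := by
      have h1 : g₀ ≤ η * δ / (2 * (A + 1) * (b + 1)) := min_le_right _ _
      rw [le_div_iff₀ (by positivity)] at h1
      rw [le_div_iff₀ (by positivity)]
      nlinarith [mul_nonneg hg₀pos.le hb0']
    have he_big : (A + 1) / δ < e := by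
      by_contra hcon
      push Not at hcon
      have h1 : g₀ * (b * e) ≤ η * δ / (2 * (A + 1)) * ((A + 1) / δ) := by
        calc g₀ * (b * e) = (g₀ * b) * e := by ring
          _ ≤ η * δ / (2 * (A + 1)) * e := mul_le_mul_of_nonneg_right hgb he0
          _ ≤ η * δ / (2 * (A + 1)) * ((A + 1) / δ) := mul_le_mul_of_nonneg_left hcon (by positivity)
      have h2 : η * δ / (2 * (A + 1)) * ((A + 1) / δ) = η / 2 := by field_simp
      linarith
    show T ≤ configEnergy z
    rw [hT, div_le_iff₀ hδ]
    rw [he, div_lt_iff₀ hδ] at he_big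
    have h1 : (A + 1) < (((N + 1 : ℕ) : ℝ))⁻¹ * configEnergy z * δ := he_big
    have h2 : (((N + 1 : ℕ) : ℝ)) = (N : ℝ) + 1 := by push_cast; ring
    rw [h2] at h1
    have h3 : ((N : ℝ) + 1)⁻¹ * configEnergy z * δ * ((N : ℝ) + 1) = configEnergy z * δ := by field_simp
    have h4 : (A + 1) * ((N : ℝ) + 1) < configEnergy z * δ := by
      have := mul_lt_mul_of_pos_right h1 hn
      rwa [h3] at this
    exact h4.le
  have hmarkov : P {z | T ≤ configEnergy z} ≤ ENNReal.ofReal δ := by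
    have h1 := mul_meas_ge_le_integral_of_nonneg (μ := P) (Eventually.of_forall fun z => ?_) hEint T
    swap
    · unfold configEnergy; exact mul_nonneg (by norm_num) (Finset.sum_nonneg fun i _ => sq_nonneg _)
    have h2 : T * P.real {z | T ≤ configEnergy z} ≤ A * ((N : ℝ) + 1) := h1.trans hEle
    have h3 : P.real {z | T ≤ configEnergy z} ≤ δ := by
      by_contra hcon
      push Not at hcon
      have : T * δ < T * P.real {z | T ≤ configEnergy z} := mul_lt_mul_of_pos_left hcon hTpos
      have h4 : T * δ = (A + 1) * ((N : ℝ) + 1) := by rw [hT]; field_simp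
      nlinarith
    calc P {z | T ≤ configEnergy z} = ENNReal.ofReal (P.real {z | T ≤ configEnergy z}) :=
          (ENNReal.ofReal_toReal (measure_ne_top _ _)).symm
      _ ≤ ENNReal.ofReal δ := ENNReal.ofReal_le_ofReal h3
  calc P _ ≤ P ({z | T ≤ configEnergy z} ∪ (Φ N).goodᶜ) := measure_mono hsub
    _ ≤ P {z | T ≤ configEnergy z} + P (Φ N).goodᶜ := measure_union_le _ _
    _ ≤ ENNReal.ofReal δ + 0 := add_le_add hmarkov hgood.le
    _ = ENNReal.ofReal δ := add_zero _

end Summit.AtomisticToContinuum.HydrodynamicLimit.Theorems.RateFloorGAfterEta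

end
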